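import Summits.ABC.IUTFork.Joshi.ArithmeticoidsInequivalent
import Summits.ABC.IUTFork.Joshi.ArithmeticoidsToyModel

/-!
# Two MODELS of `ATS2h.DeformationDatum` with residue fields `ℚ(X)` under TWO TOPOLOGIES ([J-2½] arXiv:2305.10398 §5.5):
# Thm. 5.5.2 (7) and its ground `LocalTopInequivalent` are SATISFIABLE; «`V^arc` finite» cannot be dropped in p440813

Block E support file (cell abc-iut, rung LADDER-ABC:A2.E; seat abc-iut-E-t38, [J-2½] typer lineage, consumer of `Thm552_7` BY NAME
via p432383 / p431769; the Hilbert-hotel model was handed over by the row's author lineage, seat E-t37, STATUS 2026-08-26 11:22Z).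
Same source and conventions as E-t37's object files `Arithmeticoids` p430482 / `ArithmeticoidProperties` p430871 (the claim-`Prop`s
`DeformationDatum.TopEquivalent`, `LocalTopInequivalent`, `Thm552_7`), `ArithmeticoidsFactorMatching` p437051 (`topEquivalent_of_perm`) and
`ArithmeticoidsInequivalent` p440813 (`thm552_7_of_localTopInequivalent (hfin : D.Varc.Finite) (hne : ∃ v, v ∉ D.Varc)
(h : D.LocalTopInequivalent) : D.Thm552_7`): [J-2½] = K. Joshi, arXiv:2305.10398 (lit key `paper:arxiv-2305.10398`, bib
`Joshi2023ATS2half`; «p.N l.M» = line M of `HOME/plan/repair/lit/renders/Joshi-arxiv-2305.10398-ATS2half/pNNNN.txt`). TAKES NO SIDE on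
[IUTchIII] Cor. 3.12, on Joshi's claims, or on Mochizuki's reports on them; typed ≠ proved; a model exhibits (un)satisfiability of TYPED
hypotheses over the abstract signature and says nothing about number fields. The models are [folklore]; `[claim: Joshi2023ATS2half,
status: disputed]` tags only the quoted claim-`Prop`s.

THE CARRIER (`TwoTop.ResFld`). One field, `ℚ(X)` (Mathlib `RatFunc ℚ`), under two topologies: `ResFld false` carries Mathlib's
`X`-adic valuation topology (`RatFunc.valuedRatFunc`), `ResFld true` the DISCRETE topology. They are NOT isomorphic as topological fields
(`not_iso_true_false`, `not_iso_false_true`: `{0}` is open in one and not in the other, `RatFuncX.not_isOpen_zero`) although they are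
the same abstract field — the shape of print's [Kedlaya–Temkin 2018] pairs of untilts (p.35 l.23–30), which are abstractly isomorphic
fields (algebraically closed, characteristic `0`, cardinality `2^ℵ₀`) that are not homeomorphically isomorphic. The valuation `|−|_K` is
E-t37's toy degree absolute value `Toy.degAbs` (p432522) at every point; the signature does not tie the topology of `K_y` to `|−|_{K_y}`
(a feature of the typed signature this file uses, LOCATED for the faithfulness lane, no verdict). `L = ℚ`, `L_v = ℚ(X)`,
`ι_y = id`, `α = 1`, trivial groups / actions / Frobenius, `|Y_v| = Bool` at every place; the generic constructor `TwoTop.mkDatum`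
takes the set of places `V`, the archimedean ones `V^arc`, and a SELECTOR `sel v b` saying which topology the point `b` at `v` carries.
(`instance`s are declared only on the fresh synonym family `ResFld`, the `WithAbs`/`WithVal` idiom; none on existing types.)

MODEL 1 (`twoPt`: ONE non-archimedean place, its two points carrying the two topologies). VERDICTS: `LocalTopInequivalent` HOLDS
(`twoPt_localTopInequivalent`) and `Thm552_7` HOLDS (`twoPt_thm552_7`, obtained FROM p440813 `thm552_7_of_localTopInequivalent`, whose
three hypotheses are thereby jointly satisfied with a non-trivial conclusion; also directly, E-t37's p437051 «unmatched» triple exists,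
`twoPt_unmatched`). Both claim-`Prop`s FAIL at E-t37's one-point toy (`not_toy_thm552_7` p432522; `not_toy_localTopInequivalent` below)
and, by the same mechanism (residue fields independent of the point), at the number-field model — so Thm. 5.5.2 (7) and its printed
ground are CONTENTFUL and SATISFIABLE as typed: INDEPENDENT of the signature. These are the first models in the tree where they hold.

MODEL 2 (`hotel`, Hilbert's hotel: `V = ℕ`, place `0` non-archimedean with both topologies available, every place `n ≥ 1` ARCHIMEDEAN
with a single topology — the discrete one at odd `n`, the `X`-adic one at even `n ≥ 2`). VERDICTS: `LocalTopInequivalent` HOLDS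
(`hotel_localTopInequivalent`), a non-archimedean place exists, `V^arc` is INFINITE (`hotel_varc_infinite`), and `Thm552_7` FAILS
(`hotel_not_thm552_7`): ANY two arithmeticoids are topologically equivalent (`hotel_topEquivalent`), by a PERMUTATION OF THE PLACES
matching the infinitely many discrete-type places with each other and the infinitely many `X`-adic-type places with each other
(`exists_perm_of_infinite` + p437051 `topEquivalent_of_perm`) — whatever happens at place `0` is absorbed. MORAL, against p440813: in
`thm552_7_of_localTopInequivalent` the hypothesis «`V^arc` finite» CANNOT BE DROPPED over the abstract signature (for a number field it
holds, and the kernel proves (7) there); print's ground `LocalTopInequivalent` plus a non-archimedean place ALONE do not give (7). The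
model exploits that the signature lets archimedean residue fields have the topological type of non-archimedean ones; in print they do
not (archimedean untilts are `(ℂ, |−|^θ_ℂ)`, p.12 l.21–22, Prop. 2.4.3 — connected; non-archimedean ones are totally disconnected).
-/

noncomputable section

open TopologicalSpace MonoidWithZeroHom MonoidWithZeroHom.ValueGroup₀

namespace Summit.ABC.IUTFork.Joshi.ATS2h

/-! ## 0. The `X`-adic topology of `ℚ(X)` is not discrete -/

/-- In the `X`-adic topology of `ℚ(X)` (Mathlib's `RatFunc.valuedRatFunc`, the `(X)`-adic valuation, surjective onto `ℤₘ₀`) the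
singleton `{0}` is NOT open: every basic neighbourhood `{y | v y < γ}` of `0` contains a non-zero `y` (of valuation just below `γ`).
[folklore] -/
theorem RatFuncX.not_isOpen_zero : ¬ IsOpen ({0} : Set (RatFunc ℚ)) := by
  intro h
  have h0 : ({0} : Set (RatFunc ℚ)) ∈ nhds (0 : RatFunc ℚ) := h.mem_nhds rfl
  rw [Valued.mem_nhds_zero] at h0
  obtain ⟨γ, hγ⟩ := h0
  -- the value of the unit `γ` inside `ℤₘ₀`
  set g : WithZero (Multiplicative ℤ) := embedding (γ : ValueGroup₀ (.ofClass (Valued.v (R := RatFunc ℚ)))) with hg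
  have hg0 : g ≠ 0 := fun h0 => Units.ne_zero γ (embedding_injective (h0.trans (map_zero _).symm))
  obtain ⟨y, hy⟩ := RatFunc.valuation_surjective ℚ (WithZero.exp (WithZero.log g - 1))
  have hy0 : y ≠ 0 := by
    rintro rfl
    rw [map_zero] at hy
    exact WithZero.exp_ne_zero hy.symm
  have hlt : Valued.v y < g := by
    rw [hy]
    conv_rhs => rw [← WithZero.exp_log hg0]
    exact WithZero.exp_lt_exp.2 (sub_one_lt _)
  exact hy0 (hγ ((Valuation.restrict_lt_iff_lt_embedding _).2 hlt))

/-- A DISCRETE topological ring is homeomorphically isomorphic to no topological ring in which `{0}` is not open (the isomorphism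
would carry the open set `{0}` to `{0}`). [folklore] -/
theorem not_iso_of_discrete {A B : Type} [NonAssocSemiring A] [NonAssocSemiring B] [TopologicalSpace A] [TopologicalSpace B]
    [DiscreteTopology A] (hB : ¬ IsOpen ({0} : Set B)) : ¬ ∃ f : A ≃+* B, Continuous f ∧ Continuous f.symm := by
  rintro ⟨f, -, hf'⟩
  apply hB
  have hset : ({0} : Set B) = f.symm ⁻¹' {0} := by
    ext b
    simp
  rw [hset]
  exact (isOpen_discrete _).preimage hf'

/-- … nor is such a ring homeomorphically isomorphic to a discrete one. [folklore] -/
theorem not_iso_to_discrete {A B : Type} [NonAssocSemiring A] [NonAssocSemiring B] [TopologicalSpace A] [TopologicalSpace B]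
    [DiscreteTopology A] (hB : ¬ IsOpen ({0} : Set B)) : ¬ ∃ f : B ≃+* A, Continuous f ∧ Continuous f.symm :=
  fun h => not_iso_of_discrete hB (TopFieldIso.symm h)

namespace TwoTop

/-! ## 1. The carrier: `ℚ(X)` under two topologies -/

/-- The residue-field carrier of the models: the field `ℚ(X)` tagged by a Boolean — `false` for Mathlib's `X`-adic topology,
`true` for the discrete topology (one abstract field, two topological fields: the [Kedlaya–Temkin] shape of p.35 l.23–30). A fresh
type synonym, so that the two topologies can be registered as instances without touching `RatFunc ℚ`. [folklore] -/
def ResFld (_b : Bool) : Type := RatFunc ℚ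

/-- The field structure of `ℚ(X)` on both copies. [folklore] -/
instance instField (b : Bool) : Field (ResFld b) := inferInstanceAs (Field (RatFunc ℚ))

/-- The topology: discrete on `ResFld true`, Mathlib's `X`-adic valuation topology on `ResFld false`. [folklore] -/
instance instTopologicalSpace (b : Bool) : TopologicalSpace (ResFld b) :=
  cond b ⊥ (inferInstanceAs (TopologicalSpace (RatFunc ℚ)))

/-- `ResFld true` is discrete. [folklore] -/
instance instDiscreteTopology : DiscreteTopology (ResFld true) := ⟨rfl⟩

/-- In `ResFld false` (the `X`-adic topology) `{0}` is not open. [folklore] -/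
theorem not_isOpen_zero_false : ¬ IsOpen ({0} : Set (ResFld false)) := RatFuncX.not_isOpen_zero

/-- The two copies are NOT isomorphic as topological fields (discrete → `X`-adic). [folklore] -/
theorem not_iso_true_false : ¬ ∃ f : ResFld true ≃+* ResFld false, Continuous f ∧ Continuous f.symm :=
  not_iso_of_discrete not_isOpen_zero_false

/-- … nor in the other direction (`X`-adic → discrete). [folklore] -/
theorem not_iso_false_true : ¬ ∃ f : ResFld false ≃+* ResFld true, Continuous f ∧ Continuous f.symm :=
  not_iso_to_discrete not_isOpen_zero_false

/-! ## 2. The generic two-topologies datum -/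

open Toy in
/-- **The two-topologies datum** over a countable set of places `V` with archimedean places `Varc` and a selector `sel`: `L = ℚ`,
`L_v = ℚ(X)` with E-t37's degree absolute value (trivial on `ℚ*`, so the product formula holds), `|Y_v| = Bool`, residue field of the
point `b` at `v` = `ResFld (sel v b)` (same field and valuation, topology chosen by `sel`), `ι = id`, `α = 1`, `y⁰_v = false`, `ϕ_v = 1`,
trivial groups and actions, `p_v = 2` off `Varc` and `1` on it, uninterpreted predicates `False`, `base = cp`. DEGENERATE by design.
[folklore] -/
def mkDatum (V : Type) [Countable V] (Varc : Set V) [DecidablePred (· ∈ Varc)] (sel : V → Bool → Bool) :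
    DeformationDatum ℚ V (fun _ => RatFunc ℚ) (fun _ => Bool) (fun v b => ResFld (sel v b)) (fun _ => Unit) (fun _ => Unit) where
  base := TiltBase.cp
  Varc := Varc
  countable_V := inferInstance
  p := fun v => if v ∈ Varc then 1 else 2
  p_prime := fun v hv => by simpa [hv] using Nat.prime_two
  p_arch := fun v hv => by simp [hv]
  toLv := fun _ => RatFunc.C
  metrizable := fun _ => inferInstance
  pt0 := fun _ => false
  frob := fun _ => Homeomorph.refl Bool
  frob_arch := fun _ _ => rfl
  gal := fun _ => 1
  ord := fun _ => 1
  ord_arch := fun _ _ => rfl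
  act := fun _ => 1
  lt := fun _ => 1
  absK := fun _ _ => degAbs
  absK_isValuedField := fun _ _ => degAbs_isValuedField
  emb := fun _ _ => RingHom.id (RatFunc ℚ)
  absLv := fun _ => degAbs
  absLv_isValuedField := fun _ => degAbs_isValuedField
  finite_absLv_ne_one := fun x => by
    show {v | degAbs (RatFunc.C (x : ℚ)) ≠ 1}.Finite
    rw [degAbs_C x.ne_zero]
    simp
  sum_log_absLv := fun x => by
    show ∑ᶠ _ : V, Real.log (degAbs (RatFunc.C (x : ℚ))) = 0
    rw [degAbs_C x.ne_zero, Real.log_one]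
    exact finsum_zero
  α := fun _ _ => 1
  α_pos := fun _ _ => one_pos
  absLv_eq_rpow := fun _ _ x => by
    rw [Real.rpow_one]
    rfl
  IsMaxComplete := fun _ _ => False
  ResidueFieldOfCompletion := fun _ _ => False
  ResidueFieldFpBar := fun _ _ => False
  valueGroupCompletion := fun _ => ∅

/-- At a place whose selector is the identity, the two points `true`, `false` have topologically inequivalent residue fields.
[folklore] -/
theorem not_iso_of_sel_id {V : Type} (sel : V → Bool → Bool) {v : V} (hv : ∀ b, sel v b = b) :
    ¬ ∃ e : ResFld (sel v true) ≃+* ResFld (sel v false), Continuous e ∧ Continuous e.symm := fun h =>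
  not_iso_true_false (TopFieldIso.trans (TopFieldIso.trans (TopFieldIso.of_eq ResFld (hv true).symm) h)
    (TopFieldIso.of_eq ResFld (hv false)))

/-! ## 3. MODEL 1: one non-archimedean place, two topologies — `LocalTopInequivalent` and `Thm552_7` HOLD -/

/-- **Model 1**: one place (`V = Unit`), non-archimedean (`V^arc = ∅`), whose two points carry the two topologies (`sel = id`).
[folklore] -/
def twoPt : DeformationDatum ℚ Unit (fun _ => RatFunc ℚ) (fun _ => Bool) (fun _ b => ResFld b) (fun _ => Unit) (fun _ => Unit) :=
  mkDatum Unit ∅ (fun _ b => b)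

/-- [J-2½] Thm. 5.5.2 (7)'s printed ground `LocalTopInequivalent` (p.35 l.23–30, «a pair of closed classical points … such that the
residue fields … are not topologically isomorphic», p430871) HOLDS in model 1: SATISFIABLE as typed. [folklore] -/
theorem twoPt_localTopInequivalent : twoPt.LocalTopInequivalent := fun _ _ =>
  ⟨true, false, not_iso_true_false⟩

/-- Seat E-t37's «unmatched» triple of p437051 `thm552_7_of_unmatched` exists in model 1 (the discrete residue field of the point
`true` matches no residue field of the arithmeticoid `false`): that hypothesis is NON-VACUOUS. [folklore] -/
theorem twoPt_unmatched : ∃ (y₁ y₂ : twoPt.Arith) (v : Unit),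
    ∀ w, ¬ ∃ f : ResFld (y₁ v) ≃+* ResFld (y₂ w), Continuous f ∧ Continuous f.symm :=
  ⟨fun _ => true, fun _ => false, (), fun _ => not_iso_true_false⟩

/-- **[J-2½] Thm. 5.5.2 (7) `Thm552_7` (p.34 l.28 «topologically inequivalent arithmeticoids of `L` also exist», p430871) HOLDS in
model 1** — obtained from p440813 `thm552_7_of_localTopInequivalent`, whose hypotheses «`V^arc` finite», «a non-archimedean place»,
`LocalTopInequivalent` are thus JOINTLY SATISFIED with a non-trivial conclusion. With `not_toy_thm552_7` (p432522: FAILS at the one-point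
toy): Thm. 5.5.2 (7) as typed is INDEPENDENT of the signature. [folklore] -/
theorem twoPt_thm552_7 : twoPt.Thm552_7 :=
  DeformationDatum.thm552_7_of_localTopInequivalent twoPt Set.finite_empty ⟨(), fun h => h⟩ twoPt_localTopInequivalent

/-- The same directly: the constant arithmeticoids `true` and `false` of model 1 are not topologically equivalent (p437051
`not_topEquivalent_of_unmatched`). [folklore] -/
theorem twoPt_not_topEquivalent : ¬ twoPt.TopEquivalent (fun _ => true) (fun _ => false) :=
  DeformationDatum.not_topEquivalent_of_unmatched twoPt () fun _ => not_iso_true_false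

/-- For contrast: `LocalTopInequivalent` FAILS at E-t37's one-point toy p432522 (one point per place, and «homeomorphically
isomorphic» is reflexive) — so the printed ground, too, is INDEPENDENT of the signature (holds in model 1, fails in the toy). [folklore] -/
theorem not_toy_localTopInequivalent : ¬ toyDatum.LocalTopInequivalent := fun h => by
  obtain ⟨y₁, y₂, hne⟩ := h () (fun hv => hv)
  exact hne TopFieldIso.refl

/-! ## 4. MODEL 2: Hilbert's hotel — `LocalTopInequivalent` HOLDS, `V^arc` is infinite, `Thm552_7` FAILS -/

/-- The selector of the hotel: at place `0` the point chooses its topology; at a place `n ≥ 1` both points carry the discrete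
topology if `n` is odd, the `X`-adic one if `n` is even. [folklore] -/
def hotelSel (v : ℕ) (b : Bool) : Bool := if v = 0 then b else decide (v % 2 = 1)

/-- At place `0` the selector is the identity. [folklore] -/
theorem hotelSel_zero (b : Bool) : hotelSel 0 b = b := by simp [hotelSel]

/-- Whatever the arithmeticoid `y`, infinitely many of its residue fields are of discrete type (all odd places). [folklore] -/
theorem hotelSel_true_infinite (y : ℕ → Bool) : {n | hotelSel n (y n) = true}.Infinite :=
  Set.infinite_of_injective_forall_mem (f := fun k : ℕ => 2 * k + 1) (fun a b h => by simpa using h)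
    (fun k => by simp [hotelSel])

/-- … and infinitely many are of `X`-adic type (all even places `≥ 2`). [folklore] -/
theorem hotelSel_false_infinite (y : ℕ → Bool) : {n | hotelSel n (y n) = false}.Infinite :=
  Set.infinite_of_injective_forall_mem (f := fun k : ℕ => 2 * k + 2) (fun a b h => by simpa using h)
    (fun k => by simp [hotelSel])

/-- **Hilbert's hotel**: two Boolean colourings of `ℕ` all four of whose colour classes are infinite differ by a permutation of `ℕ`
(infinite subsets of `ℕ` are denumerable; glue the two bijections). [folklore] -/
theorem exists_perm_of_infinite (c₁ c₂ : ℕ → Bool) (h₁t : {n | c₁ n = true}.Infinite) (h₁f : {n | c₁ n = false}.Infinite)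
    (h₂t : {n | c₂ n = true}.Infinite) (h₂f : {n | c₂ n = false}.Infinite) : ∃ σ : ℕ ≃ ℕ, ∀ n, c₂ (σ n) = c₁ n := by
  classical
  set S₁ : Set ℕ := {n | c₁ n = true} with hS₁
  set S₂ : Set ℕ := {n | c₂ n = true} with hS₂
  have hc₁ : S₁ᶜ = {n | c₁ n = false} := by ext n; simp [hS₁]
  have hc₂ : S₂ᶜ = {n | c₂ n = false} := by ext n; simp [hS₂]
  haveI : Infinite S₁ := h₁t.to_subtype
  haveI : Infinite S₂ := h₂t.to_subtype
  haveI : Infinite (S₁ᶜ : Set ℕ) := (hc₁ ▸ h₁f).to_subtype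
  haveI : Infinite (S₂ᶜ : Set ℕ) := (hc₂ ▸ h₂f).to_subtype
  haveI : Denumerable S₁ := Nat.Subtype.denumerable S₁
  haveI : Denumerable S₂ := Nat.Subtype.denumerable S₂
  haveI : Denumerable (S₁ᶜ : Set ℕ) := Nat.Subtype.denumerable (S₁ᶜ : Set ℕ)
  haveI : Denumerable (S₂ᶜ : Set ℕ) := Nat.Subtype.denumerable (S₂ᶜ : Set ℕ)
  let eT : S₁ ≃ S₂ := (Denumerable.eqv S₁).trans (Denumerable.eqv S₂).symm
  let eF : (S₁ᶜ : Set ℕ) ≃ (S₂ᶜ : Set ℕ) := (Denumerable.eqv (S₁ᶜ : Set ℕ)).trans (Denumerable.eqv (S₂ᶜ : Set ℕ)).symm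
  refine ⟨(Equiv.Set.sumCompl S₁).symm.trans ((Equiv.sumCongr eT eF).trans (Equiv.Set.sumCompl S₂)), fun n => ?_⟩
  by_cases hn : n ∈ S₁
  · have h2 : ((eT ⟨n, hn⟩ : S₂) : ℕ) ∈ S₂ := (eT ⟨n, hn⟩).2
    rw [Equiv.trans_apply, Equiv.trans_apply, Equiv.Set.sumCompl_symm_apply_of_mem hn, Equiv.sumCongr_apply, Sum.map_inl,
      Equiv.Set.sumCompl_apply_inl]
    exact h2.trans hn.symm
  · have h2 : ¬ c₂ ((eF ⟨n, hn⟩ : (S₂ᶜ : Set ℕ)) : ℕ) = true := (eF ⟨n, hn⟩).2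
    have hn' : c₁ n = false := by simpa [hS₁] using hn
    rw [Equiv.trans_apply, Equiv.trans_apply, Equiv.Set.sumCompl_symm_apply_of_notMem hn, Equiv.sumCongr_apply, Sum.map_inr,
      Equiv.Set.sumCompl_apply_inr, hn']
    simpa using h2

/-- **Model 2** (Hilbert's hotel): `V = ℕ`, `V^arc = {n | n ≠ 0}`, selector `hotelSel`. [folklore] -/
def hotel : DeformationDatum ℚ ℕ (fun _ => RatFunc ℚ) (fun _ => Bool) (fun v b => ResFld (hotelSel v b)) (fun _ => Unit)
    (fun _ => Unit) :=
  mkDatum ℕ {n | n ≠ 0} hotelSel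

/-- Place `0` is the (only) non-archimedean place of the hotel. [folklore] -/
theorem hotel_zero_not_mem_varc : (0 : ℕ) ∉ hotel.Varc := fun h => h rfl

/-- The hotel has INFINITELY many archimedean places (all `n ≥ 1`) — the hypothesis «`V^arc` finite» of p440813 fails here.
[folklore] -/
theorem hotel_varc_infinite : hotel.Varc.Infinite :=
  Set.infinite_of_injective_forall_mem (f := fun k : ℕ => k + 1) (fun a b h => by simpa using h) fun k => Nat.succ_ne_zero k

/-- [J-2½] Thm. 5.5.2 (7)'s printed ground `LocalTopInequivalent` (p.35 l.23–30, p430871) HOLDS in the hotel (at its non-archimedean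
place `0` the two points carry the two topologies). [folklore] -/
theorem hotel_localTopInequivalent : hotel.LocalTopInequivalent := by
  intro v hv
  have hv0 : v = 0 := by
    by_contra h
    exact hv h
  subst hv0
  exact ⟨true, false, not_iso_of_sel_id hotelSel hotelSel_zero⟩

/-- **In the hotel ANY two arithmeticoids are topologically equivalent** ([J-2½] Def. 5.2.1, p.31 l.44–45, as `TopEquivalent` p430871):
permute the places so that discrete-type places go to discrete-type places and `X`-adic-type places to `X`-adic-type places
(`exists_perm_of_infinite`; both types occur infinitely often for every arithmeticoid), then assemble the product isomorphism by
p437051 `topEquivalent_of_perm`. [folklore] -/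
theorem hotel_topEquivalent (y₁ y₂ : hotel.Arith) : hotel.TopEquivalent y₁ y₂ := by
  obtain ⟨σ, hσ⟩ := exists_perm_of_infinite (fun n => hotelSel n (y₁ n)) (fun n => hotelSel n (y₂ n))
    (hotelSel_true_infinite y₁) (hotelSel_false_infinite y₁) (hotelSel_true_infinite y₂) (hotelSel_false_infinite y₂)
  exact DeformationDatum.topEquivalent_of_perm hotel σ fun v => TopFieldIso.of_eq ResFld (hσ v).symm

/-- **[J-2½] Thm. 5.5.2 (7) `Thm552_7` (p.34 l.28, p430871) FAILS in the hotel**, although `LocalTopInequivalent` holds and a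
non-archimedean place exists: so in p440813 `thm552_7_of_localTopInequivalent` the hypothesis «`V^arc` finite» cannot be dropped
over the abstract signature — print's ground plus a non-archimedean place ALONE do not yield (7). (For a number field `V^arc` IS finite
and the kernel proves (7), p440813; no verdict on print.) [folklore] -/
theorem hotel_not_thm552_7 : ¬ hotel.Thm552_7 := fun ⟨y₁, y₂, h⟩ => h (hotel_topEquivalent y₁ y₂)

/-- Summary of model 2 in one line: printed ground ∧ a non-archimedean place ∧ `V^arc` infinite ∧ ¬ (7). [folklore] -/
theorem hotel_verdict :
    hotel.LocalTopInequivalent ∧ (∃ v, v ∉ hotel.Varc) ∧ hotel.Varc.Infinite ∧ ¬ hotel.Thm552_7 :=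
  ⟨hotel_localTopInequivalent, ⟨0, hotel_zero_not_mem_varc⟩, hotel_varc_infinite, hotel_not_thm552_7⟩

end TwoTop

end Summit.ABC.IUTFork.Joshi.ATS2h
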